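import Summits.BirchSwinnertonDyer.BirchSwinnertonDyer.Theorems.UniversalToricDescentResidualLinkLayerRank
import Summits.BirchSwinnertonDyer.BirchSwinnertonDyer.Theorems.UniversalToricDescentResidualLayerControl
import Literature.NumberTheory.EllipticCurves.GaloisActionProofs
import HarnessLib

/-!
# Route UniversalToricDescent — the finite-level two-sided link REDUCED to one Poitou–Tate layer count: K1 at `𝔭` and at `𝔭′`,
# a layer bound on `Sel_p(E/K_n)` and the two-sided count at each layer ⟹ the residual group `R_{𝔭′}^Σ(K_∞, E[p])` is finite
# (assembly of bricks B4/B5 for the port stub `stub_residualLinkMult`, line `beta-road` v5 on crux `TwinAlgMuZeroAtThree`, stmt-BirchSwinnertonDyer-24737)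

Lead prover bsd-wall-utd-p1 g23 (`--supports stmt-BirchSwinnertonDyer-24737`). Γ_K-world. With `S_n = Sel_p(E/K_n) = selmerTorsionOver (Γ_{K_n}) p`,
`Z_𝔮(n)` = classes of `H¹(Γ_{K_n}, E[p])` with all localisations above `𝔮` zero, `R(H) = datumStrictSelmer H E[p] p (bdpData 𝔭′) Σ₀`
(relaxed above `𝔭` and `Σ₀`, strict above `𝔭′`, unramified elsewhere), the theorem
**`residual_finite_of_twoSidedLayerCount`** says: IF
* (K1) two norm-coherent Heegner families (`α² = 1`) have a layer point locally `p`-indivisible at `𝔭` (layer `k`) resp. at `𝔭′` (layer `k′`),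
* (H0) `E[p]` has no non-zero point fixed by `D_𝔭 ∩ Gal(K̄/K_∞)` or by `D_{𝔭′} ∩ Gal(K̄/K_∞)`,
* (K2, layer form) `#S_n ≤ p^{pⁿ + C}` for all `n` (`…LayerSelmerInjection`, p739348, turns the K_∞-form into this), all `S_n`, `R(Γ_{K_n})` finite,
* (PT) the TWO-SIDED LAYER COUNT `#R(Γ_{K_n}) · #(S_n ⧸ S_n ∩ Z_𝔭(n)) · #(S_n ⧸ S_n ∩ Z_{𝔭′}(n)) ≤ #S_n · p^{pⁿ + c}` for all `n` — the
  content of Poitou–Tate at the layer (Castella 2017 App. A (A.4)–(A.7) mod `p`; in the tree: g18's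
  `…RelaxedKummerPairCountStrict.natCard_relaxedQuotient_mul_natCard_strictQuotient_eq` at `κ.layer n`, to be transported to Γ_K-world),
THEN `R(Gal(K̄/K_∞))` is finite. Proof: `…ResidualLinkLayerRank` (p739638) gives `#(S_n ⧸ S_n ∩ Z_𝔮(n)) ≥ p^{pⁿ − p^{k_𝔮} + 1}` for `n ≥ k, k′`,
so `#R(Γ_{K_n}) ≤ p^{C + c + p^k + p^{k′}}` for all large `n` (and is finite for the small ones); `…ResidualLayerControl`
(p739148) concludes. What then remains of the stub: the PT layer count (B3) and the two local/K2 conversions; the stub's conclusion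
follows from `R` finite by `…ResidualSelmerFinite.finite_selmerAc_pTorsion_of_finite_residualSelmer` + `…SigmaPassage`.

THEOREMS ONLY (no definition, no named fact, no `sorry`). BSD is not advanced by this file.
References: [Castella2017HeegnerBeilinsonFlach] App. A (A.3)–(A.7); [BurungaleCastellaKim2021] Thm. 4.1; [GreenbergLNM1716] §3.
-/

set_option linter.dupNamespace false
set_option autoImplicit false

noncomputable section

open scoped Classical
open Finset

namespace Summit.BirchSwinnertonDyer.BirchSwinnertonDyer.Theorems.UniversalToricDescentResidualLinkOfLayerCount

open Field NumberField IsDedekindDomain Literature.NumberTheory.EllipticCurves WeierstrassCurve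
  Literature.NumberTheory.EllipticCurves.GreenbergSelmer Literature.NumberTheory.EllipticCurves.GreenbergVatsal2000
open Summit.BirchSwinnertonDyer.Rank1Residual.X11b
open Summit.BirchSwinnertonDyer.BirchSwinnertonDyer.Theorems.UniversalToricDescentResidualLinkLayerRank
  Summit.BirchSwinnertonDyer.BirchSwinnertonDyer.Theorems.UniversalToricDescentResidualLayerControl
  Summit.BirchSwinnertonDyer.BirchSwinnertonDyer.Theorems.UniversalToricDescentHeegnerLayerSignature

variable {K : Type} [Field K] [NumberField K] {N : ℕ} [NeZero N] {W : WeierstrassCurve ℚ}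
  {p : ℕ} [hp : Fact p.Prime] {κ : ZpExtension K p} {jbar jbar' : AlgebraicClosure K →+* ℂ}

omit hp in
/-- Exponent bookkeeping: `R · A · A′ ≤ p^{X}`, `p^a ≤ A`, `p^{a′} ≤ A′`, `a + a′ + e ≥ X` ⟹ `R ≤ p^e`. [folklore] -/
theorem le_pow_of_mul_mul_le {R A A' X a a' e : ℕ} (hp1 : 1 ≤ p) (h : R * A * A' ≤ p ^ X) (hA : p ^ a ≤ A)
    (hA' : p ^ a' ≤ A') (he : X ≤ a + a' + e) : R ≤ p ^ e := by
  have hpos : 0 < p ^ a * p ^ a' := Nat.mul_pos (pow_pos hp1 a) (pow_pos hp1 a')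
  have h1 : R * (p ^ a * p ^ a') ≤ p ^ (a + a') * p ^ e := by
    calc R * (p ^ a * p ^ a') = R * p ^ a * p ^ a' := by ring
      _ ≤ R * A * A' := Nat.mul_le_mul (Nat.mul_le_mul_left _ hA) hA'
      _ ≤ p ^ X := h
      _ ≤ p ^ (a + a' + e) := Nat.pow_le_pow_right hp1 he
      _ = p ^ (a + a') * p ^ e := by rw [pow_add]
  rw [pow_add] at h1
  exact Nat.le_of_mul_le_mul_left (by simpa [mul_comm, mul_assoc, mul_left_comm] using h1) hpos

/-- **The two-sided link reduced to the layer count** (module docstring). -/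
theorem residual_finite_of_twoSidedLayerCount (F : HeegnerFamily N W K κ jbar) (F' : HeegnerFamily N W K κ jbar')
    {γ : absoluteGaloisGroup K} {α α' : ℤ} (hα : α ^ 2 = 1) (hα' : α' ^ 2 = 1)
    (hcoh : F.IsNormCompatible γ α) (hcoh' : F'.IsNormCompatible γ α')
    (𝔭 𝔭' : HeightOneSpectrum (𝓞 K)) (S₀ : Set (HeightOneSpectrum (𝓞 K))) (k k' : ℕ)
    (h0 : ∀ t : geomTorsion (W.baseChange K) (p : ℤ), (∀ σ ∈ decomp 𝔭 ⊓ κ.kerSubgroup, σ • t = t) → t = 0)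
    (h0' : ∀ t : geomTorsion (W.baseChange K) (p : ℤ), (∀ σ ∈ decomp 𝔭' ⊓ κ.kerSubgroup, σ • t = t) → t = 0)
    (hK1 : ∀ (Q : geomPoints (W.baseChange K))
      (hQ : ∀ σ ∈ κ.layerSubgroup k ⊓ decomp 𝔭, σ • ((p : ℤ) • Q) = (p : ℤ) • Q),
      (p : ℤ) • Q = F.z k → (W.baseChange K).kummerClassOver (κ.layerSubgroup k ⊓ decomp 𝔭) p Q hQ ≠ 0)
    (hK1' : ∀ (Q : geomPoints (W.baseChange K))
      (hQ : ∀ σ ∈ κ.layerSubgroup k' ⊓ decomp 𝔭', σ • ((p : ℤ) • Q) = (p : ℤ) • Q),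
      (p : ℤ) • Q = F'.z k' → (W.baseChange K).kummerClassOver (κ.layerSubgroup k' ⊓ decomp 𝔭') p Q hQ ≠ 0)
    (hSfin : ∀ n : ℕ, ((W.baseChange K).selmerTorsionOver (κ.layerSubgroup n) (p : ℤ) :
      Set ((W.baseChange K).torsionH1Over (p : ℤ) (κ.layerSubgroup n))).Finite)
    (C : ℕ) (hS : ∀ n : ℕ, Nat.card ↥((W.baseChange K).selmerTorsionOver (κ.layerSubgroup n) (p : ℤ)) ≤ p ^ (p ^ n + C))
    (hRfin : ∀ n : ℕ, (datumStrictSelmer (κ.layerSubgroup n) (↥(geomTorsion (W.baseChange K) (p : ℤ))) p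
        (AcSelmer.bdpData _ p 𝔭') S₀ :
      Set (Literature.NumberTheory.EllipticCurves.subgroupH1 (κ.layerSubgroup n)
        (↥(geomTorsion (W.baseChange K) (p : ℤ))))).Finite)
    (c : ℕ)
    (hcount : ∀ n : ℕ,
      Nat.card ↥(datumStrictSelmer (κ.layerSubgroup n) (↥(geomTorsion (W.baseChange K) (p : ℤ))) p
          (AcSelmer.bdpData _ p 𝔭') S₀) *
        Nat.card (↥((W.baseChange K).selmerTorsionOver (κ.layerSubgroup n) (p : ℤ)) ⧸
          (⨅ σ : absoluteGaloisGroup K,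
            (AddMonoidHom.ker (Literature.NumberTheory.EllipticCurves.resOfLe (↥(geomTorsion (W.baseChange K) (p : ℤ)))
              (inf_le_left : κ.layerSubgroup n ⊓ decomp 𝔭 ≤ κ.layerSubgroup n))).comap
              (Literature.NumberTheory.EllipticCurves.conjH1 (κ.layerSubgroup n)
                (↥(geomTorsion (W.baseChange K) (p : ℤ))) σ)).addSubgroupOf
            ((W.baseChange K).selmerTorsionOver (κ.layerSubgroup n) (p : ℤ))) *
        Nat.card (↥((W.baseChange K).selmerTorsionOver (κ.layerSubgroup n) (p : ℤ)) ⧸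
          (⨅ σ : absoluteGaloisGroup K,
            (AddMonoidHom.ker (Literature.NumberTheory.EllipticCurves.resOfLe (↥(geomTorsion (W.baseChange K) (p : ℤ)))
              (inf_le_left : κ.layerSubgroup n ⊓ decomp 𝔭' ≤ κ.layerSubgroup n))).comap
              (Literature.NumberTheory.EllipticCurves.conjH1 (κ.layerSubgroup n)
                (↥(geomTorsion (W.baseChange K) (p : ℤ))) σ)).addSubgroupOf
            ((W.baseChange K).selmerTorsionOver (κ.layerSubgroup n) (p : ℤ))) ≤
      Nat.card ↥((W.baseChange K).selmerTorsionOver (κ.layerSubgroup n) (p : ℤ)) * p ^ (p ^ n + c)) :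
    (datumStrictSelmer κ.kerSubgroup (↥(geomTorsion (W.baseChange K) (p : ℤ))) p (AcSelmer.bdpData _ p 𝔭') S₀ :
      Set (Literature.NumberTheory.EllipticCurves.subgroupH1 κ.kerSubgroup
        (↥(geomTorsion (W.baseChange K) (p : ℤ))))).Finite := by
  set V := W.baseChange K with hV
  set M : Type := ↥(geomTorsion V (p : ℤ)) with hM
  have hp1 : 1 ≤ p := hp.out.one_le
  -- inputs of the layer-control file for `M = E[p]`
  have hstab : ∀ t : M, IsOpen (MulAction.stabilizer (absoluteGaloisGroup K) t : Set (absoluteGaloisGroup K)) := by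
    intro t
    have h := isOpen_stabilizer_point_holds V (t : geomPoints V)
    have e : (MulAction.stabilizer (absoluteGaloisGroup K) t : Set (absoluteGaloisGroup K)) =
        (MulAction.stabilizer (absoluteGaloisGroup K) (t : geomPoints V) : Set (absoluteGaloisGroup K)) := by
      ext σ
      simp only [SetLike.mem_coe, MulAction.mem_stabilizer_iff]
      exact ⟨fun h' ↦ congrArg Subtype.val h', fun h' ↦ Subtype.ext h'⟩
    rw [e]
    exact h
  have hprim : ∀ t : M, ∃ j : ℕ, p ^ j • t = 0 := fun t ↦ ⟨1, Subtype.ext (by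
    rw [pow_one, AddSubmonoidClass.coe_nsmul, ← natCast_zsmul, ZeroMemClass.coe_zero]
    exact (mem_geomTorsion_iff V _ _).1 t.2)⟩
  have hcont : ∀ t : M, Continuous fun g : absoluteGaloisGroup K ↦ g • t := continuous_smul_geomTorsion' V p
  -- (H0) at the layers
  have h0n : ∀ n : ℕ, ∀ t : M, (∀ σ ∈ κ.layerSubgroup n ⊓ decomp 𝔭, σ • t = t) → t = 0 :=
    fun n t ht ↦ h0 t fun σ hσ ↦ ht σ ⟨κ.kerSubgroup_le_layerSubgroup n hσ.2, hσ.1⟩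
  have h0n' : ∀ n : ℕ, ∀ t : M, (∀ σ ∈ κ.layerSubgroup n ⊓ decomp 𝔭', σ • t = t) → t = 0 :=
    fun n t ht ↦ h0' t fun σ hσ ↦ ht σ ⟨κ.kerSubgroup_le_layerSubgroup n hσ.2, hσ.1⟩
  -- the uniform bound on the layers
  set e₀ : ℕ := C + c + p ^ k + p ^ k' with he₀
  set Rcard : ℕ → ℕ := fun n ↦ (datumStrictSelmer (κ.layerSubgroup n) M p (AcSelmer.bdpData _ p 𝔭') S₀ :
      Set (Literature.NumberTheory.EllipticCurves.subgroupH1 (κ.layerSubgroup n) M)).ncard with hRcard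
  set B : ℕ := max ((Finset.range (max k k')).sup Rcard) (p ^ e₀) with hB
  have hbound : ∀ n : ℕ, Rcard n ≤ B := by
    intro n
    by_cases hn : n < max k k'
    · exact le_trans (Finset.le_sup (f := Rcard) (Finset.mem_range.mpr hn)) (le_max_left _ _)
    · rw [not_lt] at hn
      have hkn : k ≤ n := le_trans (le_max_left _ _) hn
      have hkn' : k' ≤ n := le_trans (le_max_right _ _) hn
      -- ranks at `𝔭` and `𝔭′`
      have hA := pow_le_natCard_selmerTorsion_quotient_of_K1 F hα hcoh 𝔭 k (n - k) (h0n (k + (n - k))) hK1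
        (hSfin (k + (n - k)))
      have hA' := pow_le_natCard_selmerTorsion_quotient_of_K1 F' hα' hcoh' 𝔭' k' (n - k') (h0n' (k' + (n - k')))
        hK1' (hSfin (k' + (n - k')))
      rw [Nat.add_sub_cancel' hkn] at hA
      rw [Nat.add_sub_cancel' hkn'] at hA'
      -- arithmetic
      have hpk : p ^ k ≤ p ^ n := Nat.pow_le_pow_right hp1 hkn
      have hpk' : p ^ k' ≤ p ^ n := Nat.pow_le_pow_right hp1 hkn'
      have h1 := le_trans (hcount n) (Nat.mul_le_mul_right _ (hS n))
      rw [← pow_add] at h1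
      have hR : Nat.card ↥(datumStrictSelmer (κ.layerSubgroup n) M p (AcSelmer.bdpData _ p 𝔭') S₀) ≤ p ^ e₀ :=
        le_pow_of_mul_mul_le hp1 h1 hA hA' (by omega)
      change (datumStrictSelmer (κ.layerSubgroup n) M p (AcSelmer.bdpData M p 𝔭') S₀ :
        Set (Literature.NumberTheory.EllipticCurves.subgroupH1 (κ.layerSubgroup n) M)).ncard ≤ B
      rw [← Nat.card_coe_set_eq]
      exact le_trans hR (le_max_right _ _)
  exact (residual_finite_of_forall_ncard_layer_le κ 𝔭' S₀ hstab hprim hcont h0' B hRfin hbound).1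

end Summit.BirchSwinnertonDyer.BirchSwinnertonDyer.Theorems.UniversalToricDescentResidualLinkOfLayerCount

end
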